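import Mathlib
import Summits.RiemannHypothesis.RiemannHypothesis.Theorems.WeilFarFloorFormPolarization
import Summits.RiemannHypothesis.RiemannHypothesis.Theorems.WeilFarFloorCoshOptimalPieces
import HarnessLib

/-!
# The residual ceiling under RH, the cosh profile's small-scale modulus, and the pole leakage across nested windows

Helper file (`--supports stmt-RiemannHypothesis-0098`, lead-track anchor: Weil-positivity window ladder, format-C far bound),
pure proofs over BUILT imports.  Seat rh-explicit-weil-1 gen15 (memo `run/shared/lean/pub/rh-explicit/rh-explicit-weil-1/FORMAT-K3.md`
§16): the three pieces of the SECOND-ORDER UPPER BOUND `λ_max(a) ≤ R_c(a) + (1+ε)·J(a)/R_c(a) + ε·e^{−a}` (under RH) that are not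
already in `WeilFarFloorCoshOptimalPieces`.

* §1 (RH) `primeShiftForm_le_profile_add_residual_of_RH`: for real Weil tests `u, f` on `[−b, b]`, `c = ∫uf/∫f²`, `r = u − c f`,
  `Q_b(u) ≤ c²Q_b(f) + 2c∫(T_b f)·r + 2(∫ r cosh(·/2))² − (2I₀ + log 4π + γ)∫r² + ∫_{(0,∞)} ρ_∞ D_t(r)` — bilinearity
  (`WeilFarFloorFormPolarization`) and the RH anatomy of the residual ALONE: Weil positivity under RH
  (`WeilPositivity.of_riemannHypothesis`) in Bombieri's Dirichlet-form shape (`weilQuadratic_re_eq_weilPoleForm_add_weilDirichletEnergy_sub`),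
  the zero side and the `sinh` part of the pole dropped.  (This is the structural step of C-XIII″; it supersedes the staged
  `WeilFarFloorCoshComponentRH`, whose route through the zero-energy identity is not needed.)
* §2 (RH-free) the cosh profile's increments at small scales: `∫(C_b(x+t) − C_b(x))² = 2(b + sinh b) − 2∫C_b(x − t)C_b(x)`
  and `≤ (b + sinh b + 3)·t` for `0 ≤ t ≤ 1 ≤ b` (from the closed-form self-overlap `FloorCosh.integral_coshTest_shift_mul`:
  `D_t = 2(b + sinh b)(1 − cosh(t/2)) + 2cosh b·sinh(t/2) + t·cosh(t/2) ≤ 2(b + sinh b)(1 − e^{−t/2}) + t·cosh(t/2)`), and the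
  two-sided modulus form feeding `exists_smoothProfile`.
* §3 (RH-free) the pole leakage of a residual across NESTED windows: if `C_m` is `(P₁+3)s²`-close to `C_{b₁}` and `u ⊥`-decomposes
  along `C_m` inside `[−b₂, b₂] ⊇ [−b₁, b₁]`, then `(∫ r cosh(·/2))² ≤ ∫r²·(2(P₁+3)s² + 4(b₂ − b₁)·P₊)` (`P₊ ≥ b₂ + sinh b₂`) —
  `WeilFarFloorCoshOptimalPieces.pole_term_le` is the case `b₂ = b₁ + s²`.
Standard axioms only; RH enters §1 as Mathlib's `RiemannHypothesis`.  Nothing here bears on the truth of RH.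
-/

set_option linter.dupNamespace false
set_option autoImplicit false

noncomputable section

open MeasureTheory Set Filter
open scoped Real Topology ArithmeticFunction.vonMangoldt

namespace Summit.RiemannHypothesis.RiemannHypothesis.Theorems.WeilFormatC

namespace FloorCoshSplit

open Literature.NumberTheory.LFunctions FloorCosh

variable {b : ℝ}

/-! ## §1 Under RH: profile component + residual ceiling -/

/-- **THE RH CEILING FOR ONE REAL WEIL TEST** (RH anatomy, zero side dropped): for a real Weil test `r` supported in `[−b, b]`,
`Q_b(r) + (2I₀ + log 4π + γ)∫r² + 2(∫ r sinh(·/2))² ≤ 2(∫ r cosh(·/2))² + ∫_{(0,∞)} ρ_∞ D_t(r)`, and `t ↦ ρ_∞(t)D_t(r)` is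
integrable on `(0, ∞)`.  (Weil positivity under RH, written through Bombieri's Dirichlet form of the window.) -/
theorem primeShiftForm_add_le_pole_add_arch_of_RH (hRH : RiemannHypothesis) {r : ℝ → ℝ}
    (hr : IsWeilTest fun x ↦ (r x : ℂ)) (hrs : tsupport (fun x ↦ (r x : ℂ)) ⊆ Icc (-b) b) :
    IntegrableOn (fun t ↦ weilArchDensity t * ∫ x, (r (x + t) - r x) ^ 2) (Ioi 0) ∧
      primeShiftForm b r
          + (2 * (∫ t in Ioi (0 : ℝ), (Real.exp (t / 2) - 1) / (2 * Real.sinh t))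
              + (Real.log (4 * π) + Real.eulerMascheroniConstant)) * (∫ x, r x ^ 2)
          + 2 * (∫ t, r t * Real.sinh (t / 2)) ^ 2
        ≤ 2 * (∫ t, r t * Real.cosh (t / 2)) ^ 2
          + ∫ t in Ioi (0 : ℝ), weilArchDensity t * ∫ x, (r (x + t) - r x) ^ 2 := by
  obtain ⟨-, hrm, ⟨Cr, hCr⟩, hrs0⟩ := weilTest_admissible hr hrs
  set N : ℝ := ∫ x, r x ^ 2 with hNdef
  -- Weil positivity under RH, in Dirichlet-form shape
  have hpos : 0 ≤ (weilQuadratic fun x ↦ (r x : ℂ)).re :=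
    WeilPositivity.of_riemannHypothesis explicit_formula_holds hRH _ hr
  rw [weilQuadratic_re_eq_weilPoleForm_add_weilDirichletEnergy_sub hr hrs] at hpos
  have hpole : weilPoleForm (fun x ↦ (r x : ℂ))
      = 2 * (∫ t, r t * Real.cosh (t / 2)) ^ 2 - 2 * (∫ t, r t * Real.sinh (t / 2)) ^ 2 := by
    have hC' : (∫ t, (r t : ℂ) * (Real.cosh (t / 2) : ℂ)) = ((∫ t, r t * Real.cosh (t / 2) : ℝ) : ℂ) := by
      rw [← integral_complex_ofReal]; exact integral_congr_ae (ae_of_all _ fun t ↦ by push_cast; ring)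
    have hS' : (∫ t, (r t : ℂ) * (Real.sinh (t / 2) : ℂ)) = ((∫ t, r t * Real.sinh (t / 2) : ℝ) : ℂ) := by
      rw [← integral_complex_ofReal]; exact integral_congr_ae (ae_of_all _ fun t ↦ by push_cast; ring)
    rw [weilPoleForm, hC', hS', Complex.norm_real, Complex.norm_real, Real.norm_eq_abs, Real.norm_eq_abs, sq_abs, sq_abs]
  have hnorm : (∫ x, ‖((r x : ℂ))‖ ^ 2) = N :=
    integral_congr_ae (ae_of_all _ fun x ↦ by simp only [Complex.norm_real, Real.norm_eq_abs, sq_abs])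
  have hinc : ∀ t, weilIncrement (fun x ↦ (r x : ℂ)) t = ∫ x, (r (x + t) - r x) ^ 2 := fun t ↦ by
    unfold weilIncrement
    exact integral_congr_ae (Eventually.of_forall fun x ↦ by
      simp only [← Complex.ofReal_sub, Complex.norm_real, Real.norm_eq_abs, sq_abs])
  -- `D_t(r) = 2N − 2∫r(x − t)r(x)`
  have hincQ : ∀ t, ∫ x, (r (x + t) - r x) ^ 2 = 2 * N - 2 * ∫ x, r (x - t) * r x := by
    intro t
    have i1 := integrable_shiftAdd_mul_shiftAdd hrm hCr hrs0 t t
    have i2 := integrable_shiftAdd_mul_shiftAdd hrm hCr hrs0 t 0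
    have i3 := integrable_shiftAdd_mul_shiftAdd hrm hCr hrs0 0 0
    simp only [add_zero] at i2 i3
    have hsq : ∀ y, r y * r y = r y ^ 2 := fun y ↦ by ring
    have e1 : ∫ x, r (x + t) * r (x + t) = N := by
      rw [integral_add_right_eq_self (fun y ↦ r y * r y) t]; simp_rw [hsq]; rfl
    have e2 : ∫ x, r (x + t) * r x = ∫ x, r (x - t) * r x := by
      rw [← integral_add_right_eq_self (fun y ↦ r (y + t) * r y) (-t)]
      refine integral_congr_ae (Eventually.of_forall fun x ↦ ?_)
      show r (x + -t + t) * r (x + -t) = r (x - t) * r x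
      rw [neg_add_cancel_right, ← sub_eq_add_neg, mul_comm]
    have e3 : ∫ x, r x * r x = N := by simp_rw [hsq]; rfl
    have e : ∀ x, (r (x + t) - r x) ^ 2 = r (x + t) * r (x + t) - 2 * (r (x + t) * r x) + r x * r x := fun x ↦ by ring
    simp_rw [e]
    rw [integral_add (f := fun x ↦ r (x + t) * r (x + t) - 2 * (r (x + t) * r x)) (g := fun x ↦ r x * r x)
        (i1.sub (i2.const_mul 2)) i3,
      integral_sub (f := fun x ↦ r (x + t) * r (x + t)) (g := fun x ↦ 2 * (r (x + t) * r x)) i1 (i2.const_mul 2),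
      integral_const_mul, e1, e2, e3]
    ring
  have hQ : primeShiftForm b r = 2 * N * (∑ n ∈ weilPrimeIndex b, (Λ n : ℝ) / Real.sqrt n)
      - ∑ n ∈ weilPrimeIndex b, (Λ n : ℝ) / Real.sqrt n * weilIncrement (fun x ↦ (r x : ℂ)) (Real.log n) := by
    unfold primeShiftForm
    rw [Finset.mul_sum, ← Finset.sum_sub_distrib]
    refine Finset.sum_congr rfl fun n _ ↦ ?_
    rw [hinc, hincQ]; ring
  have hAi : IntegrableOn (fun t ↦ weilArchDensity t * weilIncrement (fun x ↦ (r x : ℂ)) t) (Ioi 0) :=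
    integrableOn_weilArchDensity_mul_weilIncrement hr
  have hAi' : IntegrableOn (fun t ↦ weilArchDensity t * ∫ x, (r (x + t) - r x) ^ 2) (Ioi 0) :=
    hAi.congr_fun (fun t _ ↦ by simp only [hinc]) measurableSet_Ioi
  have hAeq : ∫ t in Ioi (0 : ℝ), weilArchDensity t * weilIncrement (fun x ↦ (r x : ℂ)) t
      = ∫ t in Ioi (0 : ℝ), weilArchDensity t * ∫ x, (r (x + t) - r x) ^ 2 :=
    setIntegral_congr_fun measurableSet_Ioi fun t _ ↦ by simp only [hinc]
  refine ⟨hAi', ?_⟩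
  unfold weilDirichletEnergy weilMarkovConstant at hpos
  rw [hpole, hnorm, hAeq] at hpos
  set E := ∑ n ∈ weilPrimeIndex b, (Λ n : ℝ) / Real.sqrt n * weilIncrement (fun x ↦ (r x : ℂ)) (Real.log n) with hE
  set W := ∑ n ∈ weilPrimeIndex b, (Λ n : ℝ) / Real.sqrt n with hW
  linarith only [hpos, hQ]

/-- **UNDER RH: PROFILE COMPONENT + RESIDUAL CEILING.**  For real Weil tests `u, f` supported in `[−b, b]`,
`c = ∫uf/∫f²`, `r = u − c f`:
`Q_b(u) ≤ c²Q_b(f) + 2c∫(T_b f)·r + 2(∫ r cosh(·/2))² − (2I₀ + log 4π + γ)∫r² + ∫_{(0,∞)}ρ_∞ D_t(r)`,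
and `t ↦ ρ_∞(t) D_t(r)` is integrable on `(0, ∞)`. -/
theorem primeShiftForm_le_profile_add_residual_of_RH (hRH : RiemannHypothesis) {u f : ℝ → ℝ}
    (hu : IsWeilTest fun x ↦ (u x : ℂ)) (hus : tsupport (fun x ↦ (u x : ℂ)) ⊆ Icc (-b) b)
    (hf : IsWeilTest fun x ↦ (f x : ℂ)) (hfs : tsupport (fun x ↦ (f x : ℂ)) ⊆ Icc (-b) b) :
    IntegrableOn (fun t ↦ weilArchDensity t
        * ∫ x, ((u (x + t) - (∫ y, u y * f y) / (∫ y, f y ^ 2) * f (x + t))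
            - (u x - (∫ y, u y * f y) / (∫ y, f y ^ 2) * f x)) ^ 2) (Ioi 0) ∧
      primeShiftForm b u
        ≤ ((∫ y, u y * f y) / ∫ y, f y ^ 2) ^ 2 * primeShiftForm b f
          + 2 * ((∫ y, u y * f y) / ∫ y, f y ^ 2)
            * (∫ x, (∑ n ∈ weilPrimeIndex b, (Λ n : ℝ) / Real.sqrt n * (f (x - Real.log n) + f (x + Real.log n)))
              * (u x - (∫ y, u y * f y) / (∫ y, f y ^ 2) * f x))
          + 2 * (∫ t, (u t - (∫ y, u y * f y) / (∫ y, f y ^ 2) * f t) * Real.cosh (t / 2)) ^ 2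
          - (2 * (∫ t in Ioi (0 : ℝ), (Real.exp (t / 2) - 1) / (2 * Real.sinh t))
              + (Real.log (4 * π) + Real.eulerMascheroniConstant))
            * (∫ x, (u x - (∫ y, u y * f y) / (∫ y, f y ^ 2) * f x) ^ 2)
          + ∫ t in Ioi (0 : ℝ), weilArchDensity t
              * ∫ x, ((u (x + t) - (∫ y, u y * f y) / (∫ y, f y ^ 2) * f (x + t))
                  - (u x - (∫ y, u y * f y) / (∫ y, f y ^ 2) * f x)) ^ 2 := by
  set c := (∫ y, u y * f y) / ∫ y, f y ^ 2 with hc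
  obtain ⟨-, hum, ⟨Cu, hCu⟩, hus0⟩ := weilTest_admissible hu hus
  obtain ⟨-, hfm, ⟨Cf, hCf⟩, hfs0⟩ := weilTest_admissible hf hfs
  -- the residual `r = u − c f = (−c)·f + u` is a real Weil test supported in `[−b, b]`
  set r : ℝ → ℝ := fun x ↦ u x - c * f x with hr
  have hrW : IsWeilTest fun x ↦ (r x : ℂ) := by
    -- `r = (−c)·f + u` (the landed `isWeilTest_smul_add` lives in a module without a hub olean; inlined)
    have e : (fun x ↦ (r x : ℂ)) = (fun x ↦ ((-c : ℝ) : ℂ) * (f x : ℂ)) + fun x ↦ (u x : ℂ) := by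
      funext x; simp only [hr, Pi.add_apply]; push_cast; ring
    rw [e]; exact (hf.const_mul _).add hu
  have hrs0 : ∀ x, x ∉ Icc (-b) b → r x = 0 := fun x hx ↦ by simp only [hr, hus0 x hx, hfs0 x hx, mul_zero, sub_zero]
  have hrsub : tsupport (fun x ↦ (r x : ℂ)) ⊆ Icc (-b) b := by
    refine closure_minimal (fun x hx ↦ ?_) isClosed_Icc
    by_contra h
    exact hx (by simp [hrs0 x h])
  obtain ⟨-, hrm, ⟨Cr, hCr⟩, -⟩ := weilTest_admissible hrW hrsub
  -- (1) bilinearity: `Q(u) = Q(c f + r) = c²Q(f) + Q(r) + 2c∫(T f) r`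
  have hu_eq : u = fun x ↦ c * f x + r x := funext fun x ↦ by simp only [hr]; ring
  have hbil := primeShiftForm_smul_add (b := b) hfm hrm hCf hCr hfs0 hrs0 c
  rw [← hu_eq] at hbil
  -- (2) the RH ceiling for `r` alone (`sinh` part dropped)
  obtain ⟨hAi, hceil⟩ := primeShiftForm_add_le_pole_add_arch_of_RH (b := b) hRH hrW hrsub
  have hsinh : 0 ≤ 2 * (∫ t, r t * Real.sinh (t / 2)) ^ 2 := by positivity
  refine ⟨by simpa only [hr] using hAi, ?_⟩
  have key : primeShiftForm b u
      ≤ c ^ 2 * primeShiftForm b f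
        + 2 * c * (∫ x, (∑ n ∈ weilPrimeIndex b, (Λ n : ℝ) / Real.sqrt n * (f (x - Real.log n) + f (x + Real.log n))) * r x)
        + 2 * (∫ t, r t * Real.cosh (t / 2)) ^ 2
        - (2 * (∫ t in Ioi (0 : ℝ), (Real.exp (t / 2) - 1) / (2 * Real.sinh t))
            + (Real.log (4 * π) + Real.eulerMascheroniConstant)) * (∫ x, r x ^ 2)
        + ∫ t in Ioi (0 : ℝ), weilArchDensity t * ∫ x, (r (x + t) - r x) ^ 2 := by
    rw [hbil]
    linarith only [hceil, hsinh]
  simpa only [hr] using key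

/-! ## §2 The cosh profile's increments at small scales (RH-free) -/

/-- `∫ (C_b(x+t) − C_b(x))² = 2(b + sinh b) − 2∫ C_b(x − t)C_b(x)` (`b ≥ 0`). -/
theorem coshTest_increment_eq_sub_shift_mul (hb : 0 ≤ b) (t : ℝ) :
    ∫ x, ((Icc (-b) b).indicator (fun y ↦ Real.cosh (y / 2)) (x + t) - (Icc (-b) b).indicator (fun y ↦ Real.cosh (y / 2)) x) ^ 2
      = 2 * (b + Real.sinh b) - 2 * ∫ x, (Icc (-b) b).indicator (fun y ↦ Real.cosh (y / 2)) (x - t)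
          * (Icc (-b) b).indicator (fun y ↦ Real.cosh (y / 2)) x := by
  set C := (Icc (-b) b).indicator (fun y ↦ Real.cosh (y / 2)) with hC
  obtain ⟨hCm, hCb, hCs⟩ := coshTest_admissible b
  have i1 := integrable_shiftAdd_mul_shiftAdd hCm hCb hCs t t
  have i2 := integrable_shiftAdd_mul_shiftAdd hCm hCb hCs t 0
  have i3 := integrable_shiftAdd_mul_shiftAdd hCm hCb hCs 0 0
  simp only [add_zero] at i2 i3
  have hsq : ∀ y, C y * C y = C y ^ 2 := fun y ↦ by ring
  have hP : ∫ x, C x ^ 2 = b + Real.sinh b := by rw [hC, integral_coshTest_sq hb]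
  have e1 : ∫ x, C (x + t) * C (x + t) = b + Real.sinh b := by
    rw [integral_add_right_eq_self (fun y ↦ C y * C y) t]; simp_rw [hsq]; exact hP
  have e2 : ∫ x, C (x + t) * C x = ∫ x, C (x - t) * C x := by
    rw [← integral_add_right_eq_self (fun y ↦ C (y + t) * C y) (-t)]
    refine integral_congr_ae (Eventually.of_forall fun x ↦ ?_)
    show C (x + -t + t) * C (x + -t) = C (x - t) * C x
    rw [neg_add_cancel_right, ← sub_eq_add_neg, mul_comm]
  have e3 : ∫ x, C x * C x = b + Real.sinh b := by simp_rw [hsq]; exact hP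
  have e : ∀ x, (C (x + t) - C x) ^ 2 = C (x + t) * C (x + t) - 2 * (C (x + t) * C x) + C x * C x := fun x ↦ by ring
  simp_rw [e]
  rw [integral_add (f := fun x ↦ C (x + t) * C (x + t) - 2 * (C (x + t) * C x)) (g := fun x ↦ C x * C x)
      (i1.sub (i2.const_mul 2)) i3,
    integral_sub (f := fun x ↦ C (x + t) * C (x + t)) (g := fun x ↦ 2 * (C (x + t) * C x)) i1 (i2.const_mul 2),
    integral_const_mul, e1, e2, e3]
  ring

/-- **`∫ (C_b(x+t) − C_b(x))² ≤ (b + sinh b + 3)·t`** for `0 ≤ t ≤ 1 ≤ b`: by the closed-form self-overlap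
`∫C_b(x − t)C_b(x) = sinh(b − t/2) + (2b − t)cosh(t/2)/2` the increment is
`2(b + sinh b)(1 − cosh(t/2)) + 2cosh b·sinh(t/2) + t cosh(t/2) ≤ 2(b + sinh b)(1 − e^{−t/2}) + t cosh(t/2)` (`cosh b ≤ b + sinh b`). -/
theorem coshTest_increment_le_linear (hb : 1 ≤ b) {t : ℝ} (ht0 : 0 ≤ t) (ht1 : t ≤ 1) :
    ∫ x, ((Icc (-b) b).indicator (fun y ↦ Real.cosh (y / 2)) (x + t)
        - (Icc (-b) b).indicator (fun y ↦ Real.cosh (y / 2)) x) ^ 2 ≤ (b + Real.sinh b + 3) * t := by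
  rw [coshTest_increment_eq_sub_shift_mul (by linarith) t, integral_coshTest_shift_mul ht0 (by linarith), Real.sinh_sub]
  have hP0 : 0 ≤ b + Real.sinh b := by
    have := Real.sinh_pos_iff.2 (by linarith : 0 < b); linarith
  -- `cosh b ≤ b + sinh b` (`cosh b − sinh b = e^{−b} ≤ 1 ≤ b`)
  have hcosh : Real.cosh b ≤ b + Real.sinh b := by
    have h1 : Real.cosh b - Real.sinh b = Real.exp (-b) := Real.cosh_sub_sinh b
    have h2 : Real.exp (-b) ≤ 1 := Real.exp_le_one_iff.2 (by linarith)
    linarith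
  -- `sinh(t/2) ≥ 0`, `cosh(t/2) ≥ 1`
  have hs0 : 0 ≤ Real.sinh (t / 2) := Real.sinh_nonneg_iff.2 (by linarith)
  -- `1 − cosh(t/2) + sinh(t/2) = 1 − e^{−t/2} ≤ t/2`
  have hkey : 1 - Real.cosh (t / 2) + Real.sinh (t / 2) ≤ t / 2 := by
    have h1 : Real.cosh (t / 2) - Real.sinh (t / 2) = Real.exp (-(t / 2)) := Real.cosh_sub_sinh _
    have h2 : -(t / 2) + 1 ≤ Real.exp (-(t / 2)) := Real.add_one_le_exp _
    linarith
  -- `cosh(t/2) ≤ 3`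
  have hc3 : Real.cosh (t / 2) ≤ 3 := by
    rw [Real.cosh_eq]
    have h1 : Real.exp (t / 2) ≤ Real.exp 1 := Real.exp_le_exp.2 (by linarith)
    have h2 : Real.exp (-(t / 2)) ≤ 1 := Real.exp_le_one_iff.2 (by linarith)
    have h3 : Real.exp 1 < 2.7182818286 := Real.exp_one_lt_d9
    linarith
  -- `2cosh b·sinh(t/2) ≤ 2(b + sinh b)·sinh(t/2)`
  have h4 : Real.cosh b * Real.sinh (t / 2) ≤ (b + Real.sinh b) * Real.sinh (t / 2) :=
    mul_le_mul_of_nonneg_right hcosh hs0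
  have h5 : (b + Real.sinh b) * (1 - Real.cosh (t / 2) + Real.sinh (t / 2)) ≤ (b + Real.sinh b) * (t / 2) :=
    mul_le_mul_of_nonneg_left hkey hP0
  have h6 : t * Real.cosh (t / 2) ≤ t * 3 := mul_le_mul_of_nonneg_left hc3 ht0
  nlinarith [h4, h5, h6]

/-- **The cosh profile's two-sided `L²`-modulus at scale `ε`**: for `b ≥ 1`, `ε ≤ 1` and `y ∈ [−ε, ε]`,
`∫ (C_b(x − y) − C_b(x))² ≤ (b + sinh b + 3)·ε` (the input `δ` of `exists_smoothProfile`). -/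
theorem coshTest_modulus_le (hb : 1 ≤ b) {ε : ℝ} (hε1 : ε ≤ 1) {y : ℝ} (hy : y ∈ Icc (-ε) ε) :
    ∫ x, ((Icc (-b) b).indicator (fun z ↦ Real.cosh (z / 2)) (x - y)
        - (Icc (-b) b).indicator (fun z ↦ Real.cosh (z / 2)) x) ^ 2 ≤ (b + Real.sinh b + 3) * ε := by
  have hP0 : 0 ≤ b + Real.sinh b + 3 := by
    have := Real.sinh_pos_iff.2 (by linarith : 0 < b); linarith
  set C := (Icc (-b) b).indicator (fun z ↦ Real.cosh (z / 2)) with hC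
  -- translation invariance: `∫ (C(x − s) − C(x))² = ∫ (C(x + s) − C(x))²`
  have htr : ∀ s : ℝ, ∫ x, (C (x - s) - C x) ^ 2 = ∫ x, (C (x + s) - C x) ^ 2 := by
    intro s
    have h := MeasureTheory.integral_sub_right_eq_self (μ := volume) (fun x ↦ (C x - C (x + s)) ^ 2) s
    simp only [sub_add_cancel] at h
    rw [h]
    exact integral_congr_ae (Eventually.of_forall fun x ↦ by simp only; ring)
  rcases le_or_gt 0 y with hy0 | hy0
  · rw [htr]
    exact (coshTest_increment_le_linear hb hy0 (hy.2.trans hε1)).trans (mul_le_mul_of_nonneg_left hy.2 hP0)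
  · have e : ∀ x : ℝ, x - y = x + (-y) := fun x ↦ by ring
    simp only [e]
    have hy' : -y ≤ ε := by linarith [hy.1]
    exact (coshTest_increment_le_linear hb (by linarith) (hy'.trans hε1)).trans (mul_le_mul_of_nonneg_left hy' hP0)

/-! ## §3 The pole leakage of a residual across nested windows (RH-free) -/

/-- **Pole leakage across nested windows.**  Let `C_m` be admissible on `[−b₂, b₂]` with `∫(C_{b₁} − C_m)² ≤ (P₁ + 3)s²`
(`b₁ ≤ b₂`, `b₂ + sinh b₂ ≤ P₊`, `1 ≤ b₁`), `u` admissible on `[−b₂, b₂]`, `r = u − (∫uC_m/∫C_m²)C_m`.  Then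
`(∫ r cosh(·/2))² ≤ ∫r² · (2(P₁ + 3)s² + 4(b₂ − b₁)P₊)`: the residual is orthogonal to `C_m`, which is `L²`-close to the
window's own cosh profile `C_{b₂}` (`‖C_{b₂} − C_m‖² ≤ 2‖C_{b₂} − C_{b₁}‖² + 2‖C_{b₁} − C_m‖²`, collar `≤ 2(b₂ − b₁)cosh²(b₂/2)`). -/
theorem pole_leak_le {b₁ b₂ s P₁ Pp CCm Cu : ℝ} {Cm u : ℝ → ℝ} (hb₁1 : 1 ≤ b₁) (hb₁₂ : b₁ ≤ b₂)
    (hPp : b₂ + Real.sinh b₂ ≤ Pp) (hCm : Measurable Cm) (hCmb : ∀ x, |Cm x| ≤ CCm)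
    (hCms : ∀ x, x ∉ Icc (-b₂) b₂ → Cm x = 0) (hu : Measurable u) (hCu : ∀ x, |u x| ≤ Cu)
    (hus : ∀ x, x ∉ Icc (-b₂) b₂ → u x = 0) (hPmne : (∫ x, Cm x ^ 2) ≠ 0)
    (hdist' : ∫ x, ((Icc (-b₁) b₁).indicator (fun y ↦ Real.cosh (y / 2)) x - Cm x) ^ 2 ≤ (P₁ + 3) * s ^ 2) :
    (∫ t, (u t - (∫ y, u y * Cm y) / (∫ y, Cm y ^ 2) * Cm t) * Real.cosh (t / 2)) ^ 2
      ≤ (∫ x, (u x - (∫ y, u y * Cm y) / (∫ y, Cm y ^ 2) * Cm x) ^ 2) * (2 * (P₁ + 3) * s ^ 2 + 4 * (b₂ - b₁) * Pp) := by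
  have h1 := sq_integral_residual_mul_cosh_le (B := b₂) hu hCm hCu hCmb hus hCms hPmne
  obtain ⟨hCm_, hCb, hCs⟩ := coshTest_admissible b₁
  have hCs₂ : ∀ x, x ∉ Icc (-b₂) b₂ → (Icc (-b₁) b₁).indicator (fun y ↦ Real.cosh (y / 2)) x = 0 :=
    fun x hx ↦ hCs x fun hm ↦ hx ⟨by linarith only [hm.1, hb₁₂], by linarith only [hm.2, hb₁₂]⟩
  obtain ⟨hC2m, hC2b, hC2s⟩ := coshTest_admissible b₂
  have h2 := integral_sq_sub_le_two_mul_add (B := b₂) hC2m hCm hCm_ hC2b hCmb hCb hC2s hCms hCs₂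
  have h3 := integral_sq_coshProfile_sub_coshProfile_le hb₁₂
  have h4 : Real.cosh (b₂ / 2) ^ 2 ≤ Pp := by
    have h5 := pow_le_pow_left₀ (Real.cosh_pos _).le (cosh_half_le_sqrt (b := b₂) (hb₁1.trans hb₁₂)) 2
    have hP2 : 0 ≤ b₂ + Real.sinh b₂ := by
      have := Real.self_le_sinh_iff.2 (show (0 : ℝ) ≤ b₂ by linarith only [hb₁1, hb₁₂])
      linarith only [this, hb₁1, hb₁₂]
    rw [Real.sq_sqrt hP2] at h5
    exact h5.trans hPp
  have hd0 : 0 ≤ b₂ - b₁ := by linarith only [hb₁₂]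
  have h4' : 2 * (b₂ - b₁) * Real.cosh (b₂ / 2) ^ 2 ≤ 2 * (b₂ - b₁) * Pp := mul_le_mul_of_nonneg_left h4 (by positivity)
  have h6 : ∫ x, ((Icc (-b₂) b₂).indicator (fun y ↦ Real.cosh (y / 2)) x - Cm x) ^ 2
      ≤ 2 * (P₁ + 3) * s ^ 2 + 4 * (b₂ - b₁) * Pp := by
    linarith only [h2, h3, hdist', h4']
  exact h1.trans (mul_le_mul_of_nonneg_left h6 (integral_nonneg fun x ↦ sq_nonneg _))

end FloorCoshSplit

end Summit.RiemannHypothesis.RiemannHypothesis.Theorems.WeilFormatC
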